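import Summits.KontsevichZagierPeriods.KontsevichZagierPeriods.Theorems.SoloBlindCycDet
import HarnessLib

/-!
# The cyclic tangent chart in every dimension

Dimension `k = n + 2`, indices mod `k`.  The **cyclic tangent cell** is

`T_k = {t ∈ ℝᵏ | 0 < tᵢ, tᵢ + tᵢ₊₁ + tᵢtᵢ₊₁ < 1}`

and the **cyclic tangent chart** is `Φ(t)ᵢ = S(tᵢ)/C(tᵢ₊₁)` with `S(u) = 2u/(1+u²)`,
`C(u) = (1-u²)/(1+u²)`, `W(u) = 2/(1+u²)` (`SoloBlindTanHalf`): in angles `tᵢ = tan(θᵢ/2)` this is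
`xᵢ = sin θᵢ / cos θᵢ₊₁`, the Beukers–Kolk–Calabi / Elkies chart.  Here: `T_k` is a
`ℚ`-semialgebraic subset of `(0,1)ᵏ`, `Φ(T_k) ⊆ (0,1)ᵏ`, `Φ` is differentiable on `T_k` with
derivative the cyclic bidiagonal matrix `M(cycDiag t, cycSuper t)`, and (`det_cycMatrix`)

`det DΦ(t) = (1 − (−1)ᵏ (∏ᵢ Φ(t)ᵢ)²) · ∏ᵢ W(tᵢ) > 0`

on the cell (`det_cycDeriv`, `abs_det_cycDeriv`).  Bijectivity onto the box and the move of
rule (2) are in `SoloBlindCycInverse`; the case `k = 4` is `SoloBlindTanHalf`/`SoloBlindTanChart`.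
-/

noncomputable section

namespace Summit.KontsevichZagierPeriods.KontsevichZagierPeriods.Theorems

open Set MeasureTheory
open Literature.ModelTheory.ExponentialFields (IsSemialgebraic isSemialgebraic_setOf_eval_pos)
open MvPolynomial (aeval X C)
open Literature.NumberTheory.Transcendental
open Literature.NumberTheory.Transcendental.KZ

namespace SoloBlind

variable {n : ℕ}

/-! ## The cell -/

/-- The cyclic tangent cell `T = {t | 0 < tᵢ, tᵢ + tᵢ₊₁ + tᵢtᵢ₊₁ < 1 (i mod n+2)}`. -/
def cycCell (n : ℕ) : Set (Fin (n + 2) → ℝ) :=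
  {t | ∀ i, 0 < t i ∧ t i + t (i + 1) + t i * t (i + 1) < 1}

/-- Membership in the cyclic tangent cell. -/
theorem mem_cycCell {t : Fin (n + 2) → ℝ} :
    t ∈ cycCell n ↔ ∀ i, 0 < t i ∧ t i + t (i + 1) + t i * t (i + 1) < 1 := Iff.rfl

/-- On the cell every coordinate is `< 1`. -/
theorem lt_one_of_mem_cycCell {t : Fin (n + 2) → ℝ} (ht : t ∈ cycCell n) (i : Fin (n + 2)) :
    t i < 1 := by
  obtain ⟨h0, h1⟩ := ht (i - 1)
  rw [sub_add_cancel] at h1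
  nlinarith [(ht i).1]

/-- On the cell `C(tᵢ) > 0`. -/
theorem tC_pos_of_mem_cycCell {t : Fin (n + 2) → ℝ} (ht : t ∈ cycCell n) (i : Fin (n + 2)) :
    0 < tC (t i) :=
  tC_pos (ht i).1.le (lt_one_of_mem_cycCell ht i)

/-- The cell is `ℚ`-semialgebraic. -/
theorem isSemialgebraic_cycCell (n : ℕ) : IsSemialgebraic ℚ (cycCell n) := by
  have h : cycCell n = ⋂ i ∈ (Finset.univ : Finset (Fin (n + 2))),
      ({t : Fin (n + 2) → ℝ | 0 < aeval t (X i : MvPolynomial (Fin (n + 2)) ℚ)} ∩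
        {t | 0 < aeval t (1 - X i - X (i + 1) - X i * X (i + 1) :
          MvPolynomial (Fin (n + 2)) ℚ)}) := by
    ext t
    simp only [mem_cycCell, Finset.mem_univ, iInter_true, mem_iInter, mem_inter_iff,
      mem_setOf_eq, map_sub, map_mul, map_one, MvPolynomial.aeval_X]
    refine forall_congr' fun i => and_congr Iff.rfl ?_
    constructor <;> intro h <;> linarith
  rw [h]
  exact IsSemialgebraic.biInter _ _ fun i _ =>
    (isSemialgebraic_setOf_eval_pos _).inter (isSemialgebraic_setOf_eval_pos _)

/-- The cell is measurable. -/
theorem measurableSet_cycCell (n : ℕ) : MeasurableSet (cycCell n) :=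
  IsSemialgebraic.measurableSet_holds (isSemialgebraic_cycCell n)

/-- The cell lies in the open unit box. -/
theorem cycCell_subset_kzOpenBox : cycCell n ⊆ kzOpenBox (n + 2) := fun _ ht i =>
  ⟨(ht i).1, lt_one_of_mem_cycCell ht i⟩

/-! ## The chart -/

/-- **The cyclic tangent chart** `Φ(t)ᵢ = S(tᵢ)/C(tᵢ₊₁)`. -/
def cycChart (n : ℕ) (t : Fin (n + 2) → ℝ) : Fin (n + 2) → ℝ := fun i => tS (t i) / tC (t (i + 1))

/-- Coordinates of the chart. -/
@[simp] theorem cycChart_apply (t : Fin (n + 2) → ℝ) (i : Fin (n + 2)) :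
    cycChart n t i = tS (t i) / tC (t (i + 1)) := rfl

/-- The chart maps the cell into the open box (`0 < S(tᵢ)/C(tᵢ₊₁) < 1` by the addition law). -/
theorem cycChart_mem {t : Fin (n + 2) → ℝ} (ht : t ∈ cycCell n) :
    cycChart n t ∈ kzOpenBox (n + 2) := by
  intro i
  have hC := tC_pos_of_mem_cycCell ht (i + 1)
  refine ⟨div_pos (tS_pos (ht i).1) hC, (div_lt_one hC).mpr ?_⟩
  exact (tS_lt_tC_iff (ht i).1.le (lt_one_of_mem_cycCell ht i) (ht (i + 1)).1.le).mpr (ht i).2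

/-- The defining relation of the chart: `Φ(t)ᵢ² · (1 - S(tᵢ₊₁)²) = S(tᵢ)²`. -/
theorem cycChart_sq_mul {t : Fin (n + 2) → ℝ} (ht : t ∈ cycCell n) (i : Fin (n + 2)) :
    cycChart n t i ^ 2 * (1 - tS (t (i + 1)) ^ 2) = tS (t i) ^ 2 := by
  rw [cycChart_apply, one_sub_tS_sq, div_pow,
    div_mul_cancel₀ _ (pow_ne_zero 2 (tC_pos_of_mem_cycCell ht (i + 1)).ne')]

/-! ## The derivative and its determinant -/

/-- Diagonal entries of `DΦ`: `∂Φᵢ/∂tᵢ = C(tᵢ)W(tᵢ)/C(tᵢ₊₁)`. -/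
def cycDiag (t : Fin (n + 2) → ℝ) (i : Fin (n + 2)) : ℝ := tC (t i) * tW (t i) / tC (t (i + 1))

/-- Cyclic superdiagonal entries of `DΦ`: `∂Φᵢ/∂tᵢ₊₁ = S(tᵢ)S(tᵢ₊₁)W(tᵢ₊₁)/C(tᵢ₊₁)²`. -/
def cycSuper (t : Fin (n + 2) → ℝ) (i : Fin (n + 2)) : ℝ :=
  tS (t i) * (tS (t (i + 1)) * tW (t (i + 1)) / tC (t (i + 1)) ^ 2)

/-- The derivative `DΦ(t)`: row `i` is `cycDiag t i · dtᵢ + cycSuper t i · dtᵢ₊₁`. -/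
def cycDeriv (t : Fin (n + 2) → ℝ) : (Fin (n + 2) → ℝ) →L[ℝ] (Fin (n + 2) → ℝ) :=
  ContinuousLinearMap.pi fun i : Fin (n + 2) =>
    cycDiag t i • ContinuousLinearMap.proj (R := ℝ) (φ := fun _ : Fin (n + 2) => ℝ) i +
      cycSuper t i • ContinuousLinearMap.proj (R := ℝ) (φ := fun _ : Fin (n + 2) => ℝ) (i + 1)

/-- The derivative applied to a vector. -/
theorem cycDeriv_apply (t v : Fin (n + 2) → ℝ) (i : Fin (n + 2)) :
    cycDeriv t v i = cycDiag t i * v i + cycSuper t i * v (i + 1) := by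
  simp [cycDeriv]

/-- The chart is differentiable on the cell with derivative `cycDeriv`. -/
theorem hasFDerivAt_cycChart {t : Fin (n + 2) → ℝ} (ht : t ∈ cycCell n) :
    HasFDerivAt (cycChart n) (cycDeriv t) t := by
  change HasFDerivAt (fun t i => tS (t i) / tC (t (i + 1)))
    (ContinuousLinearMap.pi fun i : Fin (n + 2) =>
      cycDiag t i • ContinuousLinearMap.proj (R := ℝ) (φ := fun _ : Fin (n + 2) => ℝ) i +
        cycSuper t i • ContinuousLinearMap.proj (R := ℝ) (φ := fun _ : Fin (n + 2) => ℝ) (i + 1))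
    t
  rw [hasFDerivAt_pi]
  intro i
  have hC : tC (t (i + 1)) ≠ 0 := (tC_pos_of_mem_cycCell ht (i + 1)).ne'
  have h1 : HasFDerivAt (fun y : Fin (n + 2) → ℝ => tS (y i))
      ((tC (t i) * tW (t i)) •
        ContinuousLinearMap.proj (R := ℝ) (φ := fun _ : Fin (n + 2) => ℝ) i) t :=
    HasDerivAt.comp_hasFDerivAt (h₂ := tS) (f := fun y : Fin (n + 2) → ℝ => y i) t
      (hasDerivAt_tS (t i)) (hasFDerivAt_apply i t)
  have h2 : HasFDerivAt (fun y : Fin (n + 2) → ℝ => (tC (y (i + 1)))⁻¹)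
      ((tS (t (i + 1)) * tW (t (i + 1)) / tC (t (i + 1)) ^ 2) •
        ContinuousLinearMap.proj (R := ℝ) (φ := fun _ : Fin (n + 2) => ℝ) (i + 1)) t :=
    HasDerivAt.comp_hasFDerivAt (h₂ := fun y => (tC y)⁻¹)
      (f := fun y : Fin (n + 2) → ℝ => y (i + 1)) t (hasDerivAt_inv_tC hC)
      (hasFDerivAt_apply (i + 1) t)
  have hf : (fun y : Fin (n + 2) → ℝ => tS (y i) / tC (y (i + 1))) =
      fun y => tS (y i) * (tC (y (i + 1)))⁻¹ := funext fun y => div_eq_mul_inv _ _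
  rw [hf]
  refine (h1.mul h2).congr_fderiv (ContinuousLinearMap.ext fun v => ?_)
  simp [cycDiag, cycSuper]
  field_simp
  ring

/-- The matrix of `DΦ(t)` is the cyclic bidiagonal matrix `M(cycDiag t, cycSuper t)`. -/
theorem toMatrix_cycDeriv (t : Fin (n + 2) → ℝ) :
    LinearMap.toMatrix' ((cycDeriv t : (Fin (n + 2) → ℝ) →L[ℝ] (Fin (n + 2) → ℝ)) :
      (Fin (n + 2) → ℝ) →ₗ[ℝ] (Fin (n + 2) → ℝ)) = cycMatrix (cycDiag t) (cycSuper t) := by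
  ext i j
  rw [LinearMap.toMatrix'_apply, ContinuousLinearMap.coe_coe, cycDeriv_apply, cycMatrix_apply]
  simp only [Pi.single_apply, mul_ite, mul_one, mul_zero]
  congr 1
  · by_cases h : j = i
    · simp [h]
    · simp [h, Ne.symm h]
  · by_cases h : j = i + 1
    · simp [h]
    · simp [h, Ne.symm h]

/-- Cyclic reindexing of a product: `∏ᵢ f(i+1) = ∏ᵢ f(i)`. -/
theorem prod_add_one_eq (f : Fin (n + 2) → ℝ) : ∏ i, f (i + 1) = ∏ i, f i :=
  Fintype.prod_equiv (Equiv.addRight 1) (fun i => f (i + 1)) f fun _ => rfl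

/-- `∏ᵢ Φ(t)ᵢ = ∏ᵢ S(tᵢ) / ∏ᵢ C(tᵢ)`. -/
theorem prod_cycChart (t : Fin (n + 2) → ℝ) :
    ∏ i, cycChart n t i = (∏ i, tS (t i)) / ∏ i, tC (t i) := by
  simp only [cycChart_apply, Finset.prod_div_distrib]
  rw [prod_add_one_eq (fun i => tC (t i))]

/-- `∏ᵢ cycDiag t i = ∏ᵢ W(tᵢ)` (the `C`'s cancel around the cycle). -/
theorem prod_cycDiag {t : Fin (n + 2) → ℝ} (hC : ∀ i, tC (t i) ≠ 0) :
    ∏ i, cycDiag t i = ∏ i, tW (t i) := by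
  unfold cycDiag
  rw [Finset.prod_div_distrib, Finset.prod_mul_distrib, prod_add_one_eq (fun i => tC (t i)),
    mul_comm, mul_div_assoc, div_self (Finset.prod_ne_zero_iff.mpr fun i _ => hC i), mul_one]

/-- `∏ᵢ cycSuper t i = (∏ S)²·(∏ W)/(∏ C)²`. -/
theorem prod_cycSuper (t : Fin (n + 2) → ℝ) :
    ∏ i, cycSuper t i = (∏ i, tS (t i)) ^ 2 * (∏ i, tW (t i)) / (∏ i, tC (t i)) ^ 2 := by
  unfold cycSuper
  rw [Finset.prod_mul_distrib,
    prod_add_one_eq (fun i => tS (t i) * tW (t i) / tC (t i) ^ 2), Finset.prod_div_distrib,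
    Finset.prod_mul_distrib, Finset.prod_pow]
  ring

/-- **The Jacobian**: `det DΦ(t) = (1 − (−1)ⁿ(∏ᵢ Φ(t)ᵢ)²) · ∏ᵢ W(tᵢ)` wherever all `C(tᵢ) ≠ 0`
(`(−1)ⁿ = (−1)ᵏ` for `k = n + 2`). -/
theorem det_cycDeriv {t : Fin (n + 2) → ℝ} (hC : ∀ i, tC (t i) ≠ 0) :
    (cycDeriv t).det = (1 - (-1) ^ n * (∏ i, cycChart n t i) ^ 2) * ∏ i, tW (t i) := by
  rw [ContinuousLinearMap.det, ← LinearMap.det_toMatrix', toMatrix_cycDeriv, det_cycMatrix,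
    prod_cycDiag hC, prod_cycSuper, prod_cycChart]
  have hC' : ∏ i, tC (t i) ≠ 0 := Finset.prod_ne_zero_iff.mpr fun i _ => hC i
  field_simp

/-- On the cell the Jacobian factor `(1 − (−1)ⁿ(∏Φᵢ)²)·∏W(tᵢ)` is positive. -/
theorem cycJac_pos {t : Fin (n + 2) → ℝ} (ht : t ∈ cycCell n) :
    0 < (1 - (-1) ^ n * (∏ i, cycChart n t i) ^ 2) * ∏ i, tW (t i) := by
  refine mul_pos ?_ (Finset.prod_pos fun i _ => tW_pos (t i))
  have hP := BoxIntegral.prod_mem_Ioo (by omega) (cycChart_mem ht)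
  have h1 : (∏ i, cycChart n t i) ^ 2 < 1 := by nlinarith [hP.1, hP.2]
  rcases neg_one_pow_eq_or ℝ n with h | h <;> rw [h] <;>
    nlinarith [sq_nonneg (∏ i, cycChart n t i)]

/-- **On the cell `|det DΦ(t)| = (1 − (−1)ⁿ(∏Φᵢ)²)·∏W(tᵢ)`.** -/
theorem abs_det_cycDeriv {t : Fin (n + 2) → ℝ} (ht : t ∈ cycCell n) :
    |(cycDeriv t).det| = (1 - (-1) ^ n * (∏ i, cycChart n t i) ^ 2) * ∏ i, tW (t i) := by
  rw [det_cycDeriv fun i => (tC_pos_of_mem_cycCell ht i).ne']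
  exact abs_of_pos (cycJac_pos ht)

/-- The chart is a `ℚ`-semialgebraic (indeed `ℚ`-rational) map on the cell. -/
theorem isSemialgebraicMapOn_cycChart : IsSemialgebraicMapOn ℚ (cycCell n) (cycChart n) := by
  refine IsSemialgebraicMapOn.of_forall (isSemialgebraic_cycCell n) fun i => ?_
  have hq : ∀ t ∈ cycCell n, aeval t ((1 + X i ^ 2) * (1 - X (i + 1) ^ 2) :
      MvPolynomial (Fin (n + 2)) ℚ) ≠ 0 := by
    intro t ht
    have h1 : (0 : ℝ) < 1 + t i ^ 2 := by positivity
    have h2 : (0 : ℝ) < 1 - t (i + 1) ^ 2 := by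
      nlinarith [(ht (i + 1)).1, lt_one_of_mem_cycCell ht (i + 1)]
    simpa using (mul_pos h1 h2).ne'
  refine (isSemialgebraicFunOn_aeval_div_aeval (isSemialgebraic_cycCell n)
    (C 2 * X i * (1 + X (i + 1) ^ 2)) ((1 + X i ^ 2) * (1 - X (i + 1) ^ 2)) hq).congr
    fun t _ => ?_
  simp only [cycChart_apply, tS, tC, map_mul, map_add, map_sub, map_pow, map_one,
    MvPolynomial.aeval_C, MvPolynomial.aeval_X, eq_ratCast, Rat.cast_ofNat]
  rw [div_div_div_eq]

end SoloBlind

end Summit.KontsevichZagierPeriods.KontsevichZagierPeriods.Theorems
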